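import Summits.KontsevichZagierPeriods.KontsevichZagierPeriods.Theses.ValuedFieldSpecialisation
import Summits.KontsevichZagierPeriods.KontsevichZagierPeriods.Theorems.ValuedFieldSpecialisationDefs
import Summits.KontsevichZagierPeriods.KontsevichZagierPeriods.Theorems.ValuedFieldSpecialisationCTConstructionElementarySliceValue
import Summits.KontsevichZagierPeriods.KontsevichZagierPeriods.Theorems.ValuedFieldSpecialisationCTConstructionDivergentMonomialsFilter
import Summits.KontsevichZagierPeriods.KontsevichZagierPeriods.Theorems.ValuedFieldSpecialisationCTConstructionConstantTermOfNormalForm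
import Literature.NumberTheory.Transcendental.KZDominatedFamilyRelations
import Summits.KontsevichZagierPeriods.KontsevichZagierPeriods.Theorems.ValuedFieldSpecialisationCTConstructionCoreEntry
import Summits.KontsevichZagierPeriods.KontsevichZagierPeriods.Theorems.ValuedFieldSpecialisationCTConstructionCoreEntryPure

/-!
# `CTConstruction` (stmt-KontsevichZagierPeriods-3495, route ValuedFieldSpecialisation) — line `registered`, lead reshapes r1–r4 (cycle 5: certified lossless)

Crux (rank 2, thesis-bearing): there is an additive constant-term map
`CT : KZ.FormalRep →+ KZ.FormalRep` with (CT1) values = constant term of the slice expansion when it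
exists, (CT2) fibred move generators ↦ `KZ.relations`, (CT3) dominated families ↦ their special fibre.

Line ("normal form + special-fibre rigidity", birth skeleton `Lines/birth.lean`, composition UNCHANGED:
`CT := FreeAbelianGroup.lift` of "generator ↦ special-fibre class `y` of a CHOSEN fibred normal form",
dimension-0 generators ↦ 0; `ctConstruction_of_normalForms` is the birth file's sorry-free composition, kept
byte-identical). Lead reshape r1 (2026-08-17, prover-line-…-3495-c1-0) of the three birth stubs into FIVE
registered stubs, all stated over LANDED vocabulary (`KZ.fibredRelations`, `KZ.IsDominatedFamily`,
`KZ.sliceValue` / `KZ.sliceEval` / `KZ.HasConstantTermAt` — files `KZFibredRelations`, `KZDominatedFamily`,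
`KZConstantTerm` — and `Summit.KontsevichZagierPeriods.ValuedFieldSpecialisation.elementaryGenerators`, file
`ValuedFieldSpecialisationDefs`; each is DEFINITIONALLY the clause inlined in the route, so the glue to the
birth signatures is `Iff.rfl`-level):

* `stub_classLevelExpansion` — unchanged: EXISTENCE of fibred normal forms, verbatim the route item
  `ClassLevelExpansion` (stmt-KontsevichZagierPeriods-3496; `classLevelExpansion_iff`: `∀ n R, of R ∈ expandable`).
* `stub_elementarySliceValue` — the slice of an elementary divergent product `P(p,q,b,d,r)` over
  `s ∈ (0,1)` is EXACTLY the divergent monomial `(-1)^b · r.value · s^(-p/q) · (log s)^b` (Fubini over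
  `u ∈ (0, s^(-p/q))`, `y ∈ [s,1]^b`, `w ∈ r.domain`). Size M.
* `stub_divergentMonomialsFilter` — the log-power scale lemma
  (`Literature.Analysis.Asymptotics.eq_zero_of_tendsto_sum_divergentMonomials`) along ANY non-trivial filter
  `l ≤ 𝓝[>] 0` (needed because fibred relations only control slices for a.e. `s`). Size S/M, Literature-side.
* `stub_constantTermOfNormalForm'` — VALUE REALISATION, general form: for any formal combination `x` whose
  slice function has constant term `c`, any elementary `D` and dominated pair `(G, y)` with `x − D − G` a
  fibred relation, `eval y = c` (from the two previous stubs, `KZ.sliceEval_ae_eq_zero`,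
  `IsDominatedFamily.tendsto_setIntegral`). With `x = of R` this is the birth stub 3 (CT1); with `x = 0` it is
  the VALUE SHADOW `eval y = 0` of special-fibre rigidity. Size M.
* `stub_specialFibreRigidityOfEval` — the CLASS core of the crux (lead's stub): an elementary-plus-dominated
  combination `D + G` lying in the fibred relations has special-fibre class `y ∈ KZ.relations`, GIVEN the value
  shadow `eval y = 0`. Why it might fail = the crux's own risk (an ambiguity witness would be an element of
  `ker eval ∖ relations`; conversely it follows from the KZ kernel conjecture). Size XL.

Glue (sorry-free, this file): `valueShadow_of`, `specialFibreRigidity_of` (birth stub 2 from the core + the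
value shadow), `constantTermOfNormalForm_of` (birth stub 3 from the general form), then the birth composition
and `CTConstruction_of : CTConstruction` (concludes the crux BY NAME).
Disproof used: none on file for this crux (no `Disproof.lean`, no `Negative/*`, no dead lines).

STATUS after lead cycle 1 (2026-08-17, see `LEAD-REPORT-c1.md` in this crux directory): stubs 3a/3b/3' LANDED
(p143777, p144445 + Literature p143637, p144252) — the value level of the crux is complete; `stub_classLevelExpansion`
is BLOCKED-ON item stmt-3496 (identical statement); `stub_specialFibreRigidityOfEval` is the open class-level core.
Sorry-free consequences ride as supports: `…Theorems/ValuedFieldSpecialisationCTConstructionComposition.lean`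
(`ctConstruction_of_normalForms_to H`, `ctConstruction_modKer_of_classLevelExpansion`,
`ctConstruction_of_classLevelExpansion_of_kzKernelConjecture`), `…CTConstructionDimZeroKernel.lean`,
`…CTConstructionCylinder.lean`.

STATUS after lead cycle 2 (2026-08-17, `LEAD-REPORT-c2.md`): the cycle-1 obstruction analysis of the core ("log-cancellation
+ torsion") is superseded. Torsion of `FormalRep ⧸ relations` is trivial (tree theorem
`MzvKernelInKZ.Negative.mem_relations_of_nsmul_mem`); `fibredRelations` is a MODULE over polynomial weights of the parameter
(registered sub-goal `stub_weightMap_mem_fibredRelations` + `stub_exists_weightRestrict`, LANDED p148911, file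
`…CTConstructionWeightMap.lean`) and is stable under Jacobian-free rational dilations of the parameter
(`stub_dilateMap_mem_fibredRelations` + `stub_exists_dilate`, LANDED p148858, `…CTConstructionDilateMap.lean`); the MOMENTS
`[s^m · ρ]_total ∈ relations` of a fibred relation `ρ` separate `log^b(1/s)` from constants, so special-fibre rigidity holds
for EXPLICIT normal forms: accessible identities `stub_logFamily_total` (LANDED p148387, `…CTConstructionLogFamilyTotal.lean`),
`stub_cylinder_weighted_total` (LANDED p148796 with all higher moments `cylinder_moment_total`, `…CTConstructionCylinderMoments.lean`),
`stub_logFamily_weighted_total` (LANDED p149109, `…CTConstructionLogFamilyWeightedTotal.lean`), assembled in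
`stub_momentRigidity_log1_cylinders` (LANDED p149739, `…CTConstructionMomentRigidity.lean`; log-elementary `D` + constant families:
`y ∈ relations` AND `D ∈ relations` — exactly the configuration cycle 1 declared blocked); `stub_momentRigidity_elementary_cylinders`
records the full reach of the method (all elementary parts over constant families). The residual, thesis-bearing content of
the core is the PURE case `stub_pureSpecialFibreRigidity` (fibred relations among GENERAL dominated families specialise),
equivalent to a specialisation functor on the families occurring in fibred chains; CORE ⇐ PURE ∧ log-cancellation by dilation
elimination. Composition of this skeleton is unchanged.

STATUS lead cycle 3 (2026-08-17, prover-line-…-3495-c3-0, RESHAPE r3 DONE): the informal reduction of cycle 2 is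
now machine-checked (`stub_specialFibreRigidityOfEval` below is proved from the two kernel stubs; sorried stubs of this file =
{`stub_classLevelExpansion` = item 3496, `stub_pureSpecialFibreRigidity`, `stub_logTwoCancellation`}). New registered KERNEL stubs in this file: `stub_pureSpecialFibreRigidity` (PURE, registered
in cycle 2) and `stub_logTwoCancellation` (`[∫_{1/2}^1 dt/t] * c ∈ relations → c ∈ relations`, the exact analogue of
`KZ.PiCancellation` / item `AyoubPiCancellation`; KZ-implied). DILATION ELIMINATION (landed: `…CTConstructionThetaPlumbing/CoreCalculus/CoreLog/CoreReduction/CoreEntry.lean`;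
`stub_specialFibreRigidityOfEval` below is the one-line consequence):
with `Θ = slabMap 0 1 ∘ dilate(μ = 2^{-Q})` (landed p148858/p149179 + `KZ.slabMap`), a typed elementary family
`E_{p,τ} ⊗ r` (coordinates of type `[s,1]` or `[μ,1]`) obeys the binomial law `Θ(E_{p,τ} ⊗ r) ≡ 2^p Σ_{S ⊆ ypos τ}
E_{p,τ_S} ⊗ r` modulo fibred relations (worker stubs `stub_dilate_typedElementary`, `stub_split_typedElementary`,
`stub_perm_typedElementary`, `stub_sorted_typed_elementary`); the power blocks `p > 0` are killed by steps `(Θ − 2^p)`,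
which multiply the special fibre by `1 − 2^p ≠ 0` (torsion is trivial), and the pure-log block by `(Θ − 1)^{b*}`, which
isolates the top log coefficient as the special fibre of a constant family (`stub_etaBox_specialFibre`,
`stub_altSum_choose_mul_pow`), removed by PURE + log2-cancellation (`stub_logPowCancellation_of_logTwo`) + the landed
elementary-net lemma of item 3498 (`stub_elementaryNet_mem_fibredRelations`).

STATUS lead cycle 4 (2026-08-17, prover-line-…-3495-c4-0, RESHAPE r4): `stub_logTwoCancellation` REMOVED from the skeleton —
the log step is redone with the weighted blow-up `β` of the parameter (defined on all families, rational structure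
constants) instead of the dilation `Θ` (whose structure constants are the classes `[log^j 2]`), so the class core follows from
PURE alone: sorried stubs of this file = {`stub_classLevelExpansion` = item 3496, `stub_pureSpecialFibreRigidity` (PURE),
`stub_coreReduction_of_pure` (PURE → CORE)}; r4 FINAL (same day): `stub_coreReduction_of_pure` PROVED and landed
(`…CTConstructionCoreEntryPure.lean` + `…BlowupBinomial/Plumbing/Nilpotence/Power.lean` + the eleven worker files `…BlowupExists/Map/Shear/
Dominated/Recast/Split/Expansion/Sorted/FibreRep`, `…PowerOnlyReduction`, `…ElementaryDegenerate`), so the sorried stubs of this file are exactly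
{`stub_classLevelExpansion` = item 3496, `stub_pureSpecialFibreRigidity` = PURE}: CTConstruction ⇐ ClassLevelExpansion ∧ PURE.

STATUS lead cycle 5 (2026-08-17, prover-line-…-3495-c5-0; NO reshape — stubs unchanged): the reduction is certified LOSSLESS
(`…Theorems/ValuedFieldSpecialisationCTConstructionPureIffSpecialFibre.lean`, p172978, registered sub-goals
`stub_pure_iff_specialFibre`, `stub_pure_of_ctConstruction`, `stub_ctConstruction_of_classLevelExpansion_of_pure`,
`stub_ctConstruction_iff_pure`): PURE ⇔ SF (the kernel stub `stub_specialFibreRigidity` of the sibling crux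
`ParametricLifting`, stmt-3498, `Fin`-indexed form), `CTConstruction` ⇒ PURE (so the kernel stub is NECESSARY), and
`ClassLevelExpansion → (CTConstruction ↔ PURE)` (the composition of this file as a tree theorem,
`stub_ctConstruction_of_classLevelExpansion_of_pure`). Hence modulo item 3496 the crux IS the kernel stub, which is also
the residual kernel of crux 3498 and is summit-implied (`pure_of_kontsevichZagierPeriods`); all its known instances in
the tree route through the kernel conjecture on the level of the special fibres (`…ParametricLiftingGradedSpecialFibre*`:
fibre dimension 0 unconditional, rational sub-rung of level 2 via Baker, level 2 ⇐ `PlanarAreas`). Recommendation of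
this lead: PROMOTE `stub_pureSpecialFibreRigidity` to a route item shared by both cruxes (see `LEAD-REPORT-c5.md`). -/

set_option linter.dupNamespace false

namespace Summit.KontsevichZagierPeriods.KontsevichZagierPeriods.Cruxes.CTConstruction.Birth

open Summit.KontsevichZagierPeriods.KontsevichZagierPeriods.Theses.ValuedFieldSpecialisation (CTConstruction ClassLevelExpansion)

/-- Stub 1 (EXISTENCE of fibred normal forms = route item `ClassLevelExpansion`, stmt-KontsevichZagierPeriods-3496,
verbatim): every `(n+1)`-dimensional family splits, modulo the subgroup generated by the fibred move generators,
into a `ℤ`-combination of elementary divergent product families plus a `ℤ`-combination of dominated families.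
Class-valued Comte–Lion–Rolin; sources ComteLionRolin2000, CluckersMiller2011, HrushovskiKazhdan2006,
Yin2018TConvexIntegration. Size L. -/
theorem stub_classLevelExpansion : ∀ (n : ℕ) (R : Literature.NumberTheory.Transcendental.KZ.IntegralRep (n + 1)), ∃ (D G : Literature.NumberTheory.Transcendental.KZ.FormalRep), (∃ (k : ℕ) (m : Fin k → ℤ) (p q b d : Fin k → ℕ) (r : (i : Fin k) → Literature.NumberTheory.Transcendental.KZ.IntegralRep (d i)) (P : (i : Fin k) → Literature.NumberTheory.Transcendental.KZ.IntegralRep (b i + d i + 1 + 1)), (∀ i, 0 < q i ∧ (0 < p i ∨ 0 < b i) ∧ (P i).domain = {z | ∃ (s u : ℝ) (y : Fin (b i) → ℝ) (w : Fin (d i) → ℝ), z = Matrix.vecCons s (Matrix.vecCons u (Fin.append y w)) ∧ 0 < s ∧ s < 1 ∧ 0 < u ∧ u ^ (q i) * s ^ (p i) < 1 ∧ (∀ j, s ≤ y j ∧ y j ≤ 1) ∧ w ∈ (r i).domain} ∧ (P i).integrand = fun z => (∏ j : Fin (b i), (z (Fin.castAdd (d i) j).succ.succ)⁻¹) * (r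 i).integrand (fun l : Fin (d i) => z (Fin.natAdd (b i) l).succ.succ)) ∧ D = ∑ i, m i • Literature.NumberTheory.Transcendental.KZ.of (P i)) ∧ (∃ (k : ℕ) (d : Fin k → ℕ) (m : Fin k → ℤ) (S : (i : Fin k) → Literature.NumberTheory.Transcendental.KZ.IntegralRep (d i + 1)) (r₀ g : (i : Fin k) → Literature.NumberTheory.Transcendental.KZ.IntegralRep (d i)), (∀ i, ((∃ ε > (0 : ℝ), ∀ z ∈ (S i).domain, 0 < z 0 → z 0 < ε → (fun i : Fin (d i) => z i.succ) ∈ (g i).domain ∧ |(S i).integrand z| ≤ (g i).integrand (fun i : Fin (d i) => z i.succ)) ∧ (∀ᵐ x : Fin (d i) → ℝ, ∀ᶠ s in nhdsWithin (0 : ℝ) (Set.Ioi 0), (Matrix.vecCons s x ∈ (S i).domain ↔ x ∈ (r₀ i).domain)) ∧ (∀ᵐ x : Fin (d i) → ℝ, x ∈ (r₀ i).domain → Filter.Tendsto (fun s : ℝ => (S i).integrand (Matrix.vecCons s x)) (nhdsWithin 0 (Set.Ioi 0)) (nhds ((r₀ i).integrand x))))) ∧ G = ∑ i, m i • Literature.NumberTheory.Transcendental.KZ.of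 (S i)) ∧ Literature.NumberTheory.Transcendental.KZ.of R - D - G ∈ AddSubgroup.closure (Literature.NumberTheory.Transcendental.KZ.domainAddRel ∪ Literature.NumberTheory.Transcendental.KZ.integrandAddRel ∪ {c | ∃ (n : ℕ) (r r' : Literature.NumberTheory.Transcendental.KZ.IntegralRep (n + 1)) (Φ : (Fin (n + 1) → ℝ) → (Fin (n + 1) → ℝ)) (Φ' : (Fin (n + 1) → ℝ) → (Fin (n + 1) → ℝ) →L[ℝ] (Fin (n + 1) → ℝ)), Literature.NumberTheory.Transcendental.IsSemialgebraicMapOn ℚ r.domain Φ ∧ (∀ x ∈ r.domain, HasFDerivWithinAt Φ (Φ' x) r.domain x) ∧ Set.InjOn Φ r.domain ∧ r'.domain = Φ '' r.domain ∧ (∀ x ∈ r.domain, r.integrand x = r'.integrand (Φ x) * |(Φ' x).det|) ∧ (∀ x ∈ r.domain, Φ x 0 = x 0) ∧ c = Literature.NumberTheory.Transcendental.KZ.of r - Literature.NumberTheory.Transcendental.KZ.of r'} ∪ {c | c ∈ Literature.NumberTheory.Transcendental.KZ.newtonLeibnizRel ∧ ∃ (n : ℕ) (r : Literature.NumberTheory.Transcendental.KZ.IntegralRep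 (n + 2)) (r' : Literature.NumberTheory.Transcendental.KZ.IntegralRep (n + 1)), c = Literature.NumberTheory.Transcendental.KZ.of r - Literature.NumberTheory.Transcendental.KZ.of r'}) := by
  sorry

/-- Stub 3a (EXACT SLICE OF AN ELEMENTARY DIVERGENT PRODUCT): for the elementary product `P` with data
`(p, q, b, d, r)` (domain `0 < s < 1`, `0 < u`, `u^q s^p < 1`, `s ≤ y_j ≤ 1`, `w ∈ r.domain`; integrand
`∏ y_j⁻¹ · r.integrand w`) and `0 < q`, the slice over every `s ∈ (0, 1)` is the single divergent monomial
`(-1)^b · r.value · s^(-p/q) · (log s)^b` (`= s^(-p/q) (log 1/s)^b · r.value`): Fubini over the fibre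
`(0, s^(-p/q)) × [s, 1]^b × r.domain`. Sources: ComteLionRolin2000 (the monomials), route Defs
(`elementaryGenerators`). Size M. LANDED (wave 1, p143777):
`Summit.KontsevichZagierPeriods.ValuedFieldSpecialisation.stub_elementarySliceValue`. -/
theorem stub_elementarySliceValue : ∀ (p q b d : ℕ) (r : Literature.NumberTheory.Transcendental.KZ.IntegralRep d) (P : Literature.NumberTheory.Transcendental.KZ.IntegralRep (b + d + 1 + 1)), 0 < q → P.domain = {z | ∃ (s u : ℝ) (y : Fin b → ℝ) (w : Fin d → ℝ), z = Matrix.vecCons s (Matrix.vecCons u (Fin.append y w)) ∧ 0 < s ∧ s < 1 ∧ 0 < u ∧ u ^ q * s ^ p < 1 ∧ (∀ j, s ≤ y j ∧ y j ≤ 1) ∧ w ∈ r.domain} → P.integrand = (fun z => (∏ j : Fin b, (z (Fin.castAdd d j).succ.succ)⁻¹) * r.integrand (fun l : Fin d => z (Fin.natAdd b l).succ.succ)) → ∀ s ∈ Set.Ioo (0 : ℝ) 1, Literature.NumberTheory.Transcendental.KZ.sliceValue P s = (-1) ^ b * r.value * s ^ (((-(p : ℚ) / q : ℚ)) : ℝ)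 * Real.log s ^ b :=
  Summit.KontsevichZagierPeriods.ValuedFieldSpecialisation.stub_elementarySliceValue

/-- Stub 3b (LOG-POWER SCALE ALONG A SUB-FILTER): if a finite real combination of DIVERGENT monomials
`s ^ a * (log s) ^ b` (`a < 0`, or `a = 0 < b`) tends to a finite limit `d` along a non-trivial filter
`l ≤ 𝓝[>] 0` (e.g. `𝓝[>] 0` restricted to a set of full measure near `0`), then `d = 0`. The tree has the case
`l = 𝓝[>] 0` (`Literature.Analysis.Asymptotics.eq_zero_of_tendsto_sum_divergentMonomials`, Kaiser2017
Lemma 4.6 / Prop. 4.7); the same dominant-monomial induction works verbatim along `l` (every comparison limit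
restricts by `Tendsto.mono_left`, uniqueness of limits needs `l.NeBot`). Literature-side
(`Literature/Analysis/Asymptotics/`). Size S/M. LANDED (wave 1, p143637 Literature `LogPowerScaleFilter` + p144445):
`Summit.KontsevichZagierPeriods.ValuedFieldSpecialisation.stub_divergentMonomialsFilter`. -/
theorem stub_divergentMonomialsFilter : ∀ (ι : Type) [Fintype ι] (a : ι → ℝ) (b : ι → ℕ) (w : ι → ℝ) (d : ℝ) (l : Filter ℝ), l.NeBot → l ≤ nhdsWithin (0 : ℝ) (Set.Ioi 0) → (∀ i, a i < 0 ∨ (a i = 0 ∧ 0 < b i)) → Filter.Tendsto (fun s : ℝ => ∑ i, w i * s ^ (a i) * Real.log s ^ (b i)) l (nhds d) → d = 0 :=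
  Summit.KontsevichZagierPeriods.ValuedFieldSpecialisation.stub_divergentMonomialsFilter

/-- Stub 3' (CONSTANT TERM OF A NORMAL FORM, general form — value realisation for CT1 AND the value shadow
of rigidity): from stubs 3a and 3b: if the slice function `sliceEval x` of a formal combination `x` has a
divergent-monomial expansion with constant term `c` at `0⁺`, `D` is a `ℤ`-combination of elementary divergent
products, `(G, y)` lies in the subgroup of `FormalRep × FormalRep` generated by the dominated pairs
`([S], [r₀])` (`KZ.IsDominatedFamily S r₀ g`), and `x − D − G ∈ KZ.fibredRelations`, then `eval y = c`.
Proof plan: `KZ.sliceEval_ae_eq_zero` gives `sliceEval x = sliceEval D + sliceEval G` for a.e. `s`;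
closure induction with stub 3a gives `sliceEval D =` a finite sum of divergent monomials on `(0,1)`; closure
induction with `IsDominatedFamily.tendsto_setIntegral` gives `sliceEval G → eval y` along `𝓝[>] 0`; along
`l := 𝓝[>] 0 ⊓ 𝓟 A` (`A` the a.e. set; non-trivial: a co-null set meets every `(0, δ)`) the difference of the
two monomial sums tends to `c − eval y`, so stub 3b gives `c = eval y`. Sources ComteLionRolin2000, Kaiser2017.
Size M. LANDED (wave 1, p144252):
`Summit.KontsevichZagierPeriods.ValuedFieldSpecialisation.stub_constantTermOfNormalForm'`. -/
theorem stub_constantTermOfNormalForm' : (∀ (p q b d : ℕ) (r : Literature.NumberTheory.Transcendental.KZ.IntegralRep d) (P : Literature.NumberTheory.Transcendental.KZ.IntegralRep (b + d + 1 + 1)), 0 < q → P.domain = {z | ∃ (s u : ℝ) (y : Fin b → ℝ) (w : Fin d → ℝ), z = Matrix.vecCons s (Matrix.vecCons u (Fin.append y w)) ∧ 0 < s ∧ s < 1 ∧ 0 < u ∧ u ^ q * s ^ p < 1 ∧ (∀ j, s ≤ y j ∧ y j ≤ 1) ∧ w ∈ r.domain} → P.integrand = (fun z => (∏ j : Fin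 b, (z (Fin.castAdd d j).succ.succ)⁻¹) * r.integrand (fun l : Fin d => z (Fin.natAdd b l).succ.succ)) → ∀ s ∈ Set.Ioo (0 : ℝ) 1, Literature.NumberTheory.Transcendental.KZ.sliceValue P s = (-1) ^ b * r.value * s ^ (((-(p : ℚ) / q : ℚ)) : ℝ) * Real.log s ^ b) → (∀ (ι : Type) [Fintype ι] (a : ι → ℝ) (b : ι → ℕ) (w : ι → ℝ) (d : ℝ) (l : Filter ℝ), l.NeBot → l ≤ nhdsWithin (0 : ℝ) (Set.Ioi 0) → (∀ i, a i < 0 ∨ (a i = 0 ∧ 0 < b i)) → Filter.Tendsto (fun s : ℝ => ∑ i, w i * s ^ (a i) * Real.log s ^ (b i)) l (nhds d) → d = 0) → ∀ (x : Literature.NumberTheory.Transcendental.KZ.FormalRep) (c : ℝ), Literature.NumberTheory.Transcendental.KZ.HasConstantTermAt (Literature.NumberTheory.Transcendental.KZ.sliceEval x) c → ∀ D ∈ AddSubgroup.closure Summit.KontsevichZagierPeriods.ValuedFieldSpecialisation.elementaryGenerators, ∀ (G y : Literature.NumberTheory.Transcendental.KZ.FormalRep), (G, y) ∈ AddSubgroup.closure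 {v : Literature.NumberTheory.Transcendental.KZ.FormalRep × Literature.NumberTheory.Transcendental.KZ.FormalRep | ∃ (n : ℕ) (S : Literature.NumberTheory.Transcendental.KZ.IntegralRep (n + 1)) (r₀ g : Literature.NumberTheory.Transcendental.KZ.IntegralRep n), Literature.NumberTheory.Transcendental.KZ.IsDominatedFamily S r₀ g ∧ v = (Literature.NumberTheory.Transcendental.KZ.of S, Literature.NumberTheory.Transcendental.KZ.of r₀)} → x - D - G ∈ Literature.NumberTheory.Transcendental.KZ.fibredRelations → Literature.NumberTheory.Transcendental.KZ.eval y = c :=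
  Summit.KontsevichZagierPeriods.ValuedFieldSpecialisation.stub_constantTermOfNormalForm'

/-- KERNEL STUB (registered, cycle 2; no worker): the PURE case of the class core — fibred relations among general
DOMINATED families specialise: if `(G, y)` lies in the subgroup generated by the dominated pairs `([S], [r₀])` and
`G ∈ KZ.fibredRelations`, then `y ∈ KZ.relations`. Equivalent to a specialisation functor on the families occurring in
fibred chains; implied by `KZKernelConjecture` (`pureSpecialFibreRigidity_of_kzKernelConjecture`), implied by the core
(`pureSpecialFibreRigidity_of_core`); no unconditional proof known (route engine: Yin2018TConvexIntegration Thm 5.28 /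
HrushovskiKazhdan2006 §8). Size XL. -/
theorem stub_pureSpecialFibreRigidity : ∀ (G y : Literature.NumberTheory.Transcendental.KZ.FormalRep), (G, y) ∈ AddSubgroup.closure {v : Literature.NumberTheory.Transcendental.KZ.FormalRep × Literature.NumberTheory.Transcendental.KZ.FormalRep | ∃ (n : ℕ) (S : Literature.NumberTheory.Transcendental.KZ.IntegralRep (n + 1)) (r₀ g : Literature.NumberTheory.Transcendental.KZ.IntegralRep n), Literature.NumberTheory.Transcendental.KZ.IsDominatedFamily S r₀ g ∧ v = (Literature.NumberTheory.Transcendental.KZ.of S, Literature.NumberTheory.Transcendental.KZ.of r₀)} → G ∈ Literature.NumberTheory.Transcendental.KZ.fibredRelations → y ∈ Literature.NumberTheory.Transcendental.KZ.relations := by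
  sorry

-- Lead cycle 5 (tree theorems, `…Theorems/ValuedFieldSpecialisationCTConstructionPureIffSpecialFibre.lean`, p172978; not
-- imported here only because the farm had not yet built that module when this skeleton was re-registered):
--   `stub_pure_of_ctConstruction : CTConstruction → PURE` (the kernel stub is NECESSARY for the crux),
--   `stub_pure_iff_specialFibre : PURE ↔ SF` (SF = `stub_specialFibreRigidity` of crux stmt-3498, `Fin`-indexed form),
--   `stub_ctConstruction_of_classLevelExpansion_of_pure : ClassLevelExpansion → PURE → CTConstruction` (this file's
--   composition as a tree theorem), `stub_ctConstruction_iff_pure : ClassLevelExpansion → (CTConstruction ↔ PURE)`.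

/-- LEAD STUB (registered, cycle 4; RESHAPE r4 — replaces the cycle-3 kernel stub `stub_logTwoCancellation`), PROVED
(`Summit.KontsevichZagierPeriods.ValuedFieldSpecialisation.coreReduction_of_pure`, file `…Theorems/ValuedFieldSpecialisationCTConstructionCoreEntryPure.lean`):
**the class core from PURE alone.** `log 2`-cancellation is ELIMINATED from the reduction by replacing, in the log step of
dilation elimination, the dilation `Θ = slab ∘ dilate(2^{-Q})` by the WEIGHTED BLOW-UP of the parameter
`β : R(s, x) ↦ (σ, t, x) ↦ (t/σ²) · R(t, x)` on `{0 < t < σ < 1}` (≡, by the fibred shear `t = σ s'`, the family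
`(σ, s', x) ↦ s' · R(σ s', x)`): `β` is defined on EVERY integrable family (mass kernel `1 − t ≤ 1`, no Comte–Lion–Rolin
input), maps `fibredRelations` into itself, maps a dominated pair `(S, r₀)` to a dominated pair with special fibre the
`s'`-weighted cylinder `r₀¹`, `2 • [r₀¹] ≡ [r₀]`, and acts on an elementary divergent product unipotently with RATIONAL
structure constants: `β (E_{a,k} ⊗ w) ≡ Σ_j C(k,j) E_{a,j} ⊗ W_{k−j}(w)` with `[W_0 w] ≡ ½ [w]`, `[W_1 w] ≡ ¼ [w]` for `a = 0`
(where `Θ` produced the `log 2`-twisted classes `[L^j × w]`). Hence `T = 2β − 1` is nilpotent on the log block modulo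
fibred relations and kills special fibres, `T^{b*}` turns the top log level `b*` into constant families with special fibre
`≡ (b*!/2^{b*}) · Z_{b*}` and everything else into power blocks, and the cycle-3 POWER-ONLY reduction (no `log 2` needed there)
plus PURE give `Z_{b*} ∈ relations`; peel (elementary net lemma of item 3498) and recurse on `b*`. Worker stubs (registered
with `stub-add`, wave 1 of cycle 4): `stub_exists_blowup`, `stub_blowupMap_mem_fibredRelations`, `stub_blowup_shear`,
`stub_isDominatedFamily_blowup`, `stub_blowup_recast`, `stub_blowup_split`, `stub_blowup_expansion`, `stub_blowup_sorted`,
`stub_exists_blowupFibreRep`; wave 2: `stub_powerOnly_reduction`, `stub_elementary_degenerate`; assembly (lead):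
`…CTConstructionBlowupPlumbing/BlowupLogStep/CoreEntryPure.lean`. Fallback: reshape r3 (`…CoreEntry.lean`,
`specialFibreRigidityOfEval_of_pure_of_logTwoCancellation`) stays valid with `stub_logTwoCancellation`. -/
theorem stub_coreReduction_of_pure : (∀ (G y : Literature.NumberTheory.Transcendental.KZ.FormalRep), (G, y) ∈ AddSubgroup.closure {v : Literature.NumberTheory.Transcendental.KZ.FormalRep × Literature.NumberTheory.Transcendental.KZ.FormalRep | ∃ (n : ℕ) (S : Literature.NumberTheory.Transcendental.KZ.IntegralRep (n + 1)) (r₀ g : Literature.NumberTheory.Transcendental.KZ.IntegralRep n), Literature.NumberTheory.Transcendental.KZ.IsDominatedFamily S r₀ g ∧ v = (Literature.NumberTheory.Transcendental.KZ.of S, Literature.NumberTheory.Transcendental.KZ.of r₀)} → G ∈ Literature.NumberTheory.Transcendental.KZ.fibredRelations → y ∈ Literature.NumberTheory.Transcendental.KZ.relations) → ∀ D ∈ AddSubgroup.closure Summit.KontsevichZagierPeriods.ValuedFieldSpecialisation.elementaryGenerators, ∀ (G y : Literature.NumberTheory.Transcendental.KZ.FormalRep), (G, y) ∈ AddSubgroup.closure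 {v : Literature.NumberTheory.Transcendental.KZ.FormalRep × Literature.NumberTheory.Transcendental.KZ.FormalRep | ∃ (n : ℕ) (S : Literature.NumberTheory.Transcendental.KZ.IntegralRep (n + 1)) (r₀ g : Literature.NumberTheory.Transcendental.KZ.IntegralRep n), Literature.NumberTheory.Transcendental.KZ.IsDominatedFamily S r₀ g ∧ v = (Literature.NumberTheory.Transcendental.KZ.of S, Literature.NumberTheory.Transcendental.KZ.of r₀)} → D + G ∈ Literature.NumberTheory.Transcendental.KZ.fibredRelations → Literature.NumberTheory.Transcendental.KZ.eval y = 0 → y ∈ Literature.NumberTheory.Transcendental.KZ.relations :=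
  Summit.KontsevichZagierPeriods.ValuedFieldSpecialisation.coreReduction_of_pure

/-- Stub 2' (SPECIAL-FIBRE RIGIDITY GIVEN THE VALUE SHADOW — the class-level core of the crux, lead's stub):
if an elementary-divergent combination `D` plus a dominated combination `G` (paired with its special-fibre
combination `y`) lies in the fibred relations, and `eval y = 0` (which stub 3' supplies), then
`y ∈ KZ.relations`: fibred relations among normal forms specialise to relations among special fibres.
Intended proof (route): Yin's measured Hrushovski–Kazhdan integral over `ℝ((t^ℚ))` read at `Γ`-weight
`t⁰(log t)⁰` (Yin2018TConvexIntegration Thm 5.28, HrushovskiKazhdan2006 §8) compared with Kaiser2017's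
`𝓟[log 1/t]`-valued measure. Why it might fail: an ambiguity witness `y ∈ ker eval ∖ relations` (it is implied
by the KZ kernel conjecture and, with ParametricLifting, implies the summit). Size XL. RESHAPE r3 (lead cycle 3): PROVED from
the two kernel stubs `stub_pureSpecialFibreRigidity` (PURE) and `stub_logTwoCancellation` (log2-cancellation) by
dilation elimination — `Summit.KontsevichZagierPeriods.ValuedFieldSpecialisation.specialFibreRigidityOfEval_of_pure_of_logTwoCancellation`,
file `…Theorems/ValuedFieldSpecialisationCTConstructionCoreEntry.lean` (+ `…CoreReduction`, `…CoreLog`, `…CoreCalculus`,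
`…ThetaPlumbing` and the nine worker files of cycle 3). RESHAPE r4 (lead cycle 4): derived from PURE ALONE through the lead stub
`stub_coreReduction_of_pure` (blow-up elimination, see its docstring); `stub_logTwoCancellation` is no longer a stub of this
skeleton. -/
theorem stub_specialFibreRigidityOfEval : ∀ D ∈ AddSubgroup.closure Summit.KontsevichZagierPeriods.ValuedFieldSpecialisation.elementaryGenerators, ∀ (G y : Literature.NumberTheory.Transcendental.KZ.FormalRep), (G, y) ∈ AddSubgroup.closure {v : Literature.NumberTheory.Transcendental.KZ.FormalRep × Literature.NumberTheory.Transcendental.KZ.FormalRep | ∃ (n : ℕ) (S : Literature.NumberTheory.Transcendental.KZ.IntegralRep (n + 1)) (r₀ g : Literature.NumberTheory.Transcendental.KZ.IntegralRep n), Literature.NumberTheory.Transcendental.KZ.IsDominatedFamily S r₀ g ∧ v = (Literature.NumberTheory.Transcendental.KZ.of S, Literature.NumberTheory.Transcendental.KZ.of r₀)} → D + G ∈ Literature.NumberTheory.Transcendental.KZ.fibredRelations → Literature.NumberTheory.Transcendental.KZ.eval y = 0 → y ∈ Literature.NumberTheory.Transcendental.KZ.relations :=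
  stub_coreReduction_of_pure stub_pureSpecialFibreRigidity

/-! ## Glue (sorry-free): the birth stubs 2 and 3 from the reshaped stubs -/

section Glue

open Literature.NumberTheory.Transcendental

/-- The VALUE SHADOW of special-fibre rigidity: under the hypotheses of birth stub 2, `eval y = 0`
(stub 3' with `x = 0`, `c = 0`). [folklore] -/
theorem valueShadow_of (h3 : ∀ (x : Literature.NumberTheory.Transcendental.KZ.FormalRep) (c : ℝ), Literature.NumberTheory.Transcendental.KZ.HasConstantTermAt (Literature.NumberTheory.Transcendental.KZ.sliceEval x) c → ∀ D ∈ AddSubgroup.closure Summit.KontsevichZagierPeriods.ValuedFieldSpecialisation.elementaryGenerators, ∀ (G y : Literature.NumberTheory.Transcendental.KZ.FormalRep), (G, y) ∈ AddSubgroup.closure {v : Literature.NumberTheory.Transcendental.KZ.FormalRep × Literature.NumberTheory.Transcendental.KZ.FormalRep | ∃ (n : ℕ) (S : Literature.NumberTheory.Transcendental.KZ.IntegralRep (n + 1)) (r₀ g : Literature.NumberTheory.Transcendental.KZ.IntegralRep n), Literature.NumberTheory.Transcendental.KZ.IsDominatedFamily S r₀ g ∧ v = (Literature.NumberTheory.Transcendental.KZ.of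 S, Literature.NumberTheory.Transcendental.KZ.of r₀)} → x - D - G ∈ Literature.NumberTheory.Transcendental.KZ.fibredRelations → Literature.NumberTheory.Transcendental.KZ.eval y = c) : ∀ D ∈ AddSubgroup.closure Summit.KontsevichZagierPeriods.ValuedFieldSpecialisation.elementaryGenerators, ∀ (G y : Literature.NumberTheory.Transcendental.KZ.FormalRep), (G, y) ∈ AddSubgroup.closure {v : Literature.NumberTheory.Transcendental.KZ.FormalRep × Literature.NumberTheory.Transcendental.KZ.FormalRep | ∃ (n : ℕ) (S : Literature.NumberTheory.Transcendental.KZ.IntegralRep (n + 1)) (r₀ g : Literature.NumberTheory.Transcendental.KZ.IntegralRep n), Literature.NumberTheory.Transcendental.KZ.IsDominatedFamily S r₀ g ∧ v = (Literature.NumberTheory.Transcendental.KZ.of S, Literature.NumberTheory.Transcendental.KZ.of r₀)} → D + G ∈ Literature.NumberTheory.Transcendental.KZ.fibredRelations → Literature.NumberTheory.Transcendental.KZ.eval y = 0 := by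
  intro D hD G y hGy hF
  refine h3 0 0 ?_ D hD G y hGy ?_
  · rw [map_zero]
    exact KZ.HasConstantTermAt.const 0
  · rw [zero_sub, ← neg_add', neg_mem_iff]
    exact hF

/-- Birth stub 2 (special-fibre rigidity, verbatim signature) from the class core (stub 2') and the value
shadow. The inlined sets are definitionally `elementaryGenerators`, the `IsDominatedFamily` pairs and
`KZ.fibredRelations`. [folklore] -/
theorem specialFibreRigidity_of (h2 : ∀ D ∈ AddSubgroup.closure Summit.KontsevichZagierPeriods.ValuedFieldSpecialisation.elementaryGenerators, ∀ (G y : Literature.NumberTheory.Transcendental.KZ.FormalRep), (G, y) ∈ AddSubgroup.closure {v : Literature.NumberTheory.Transcendental.KZ.FormalRep × Literature.NumberTheory.Transcendental.KZ.FormalRep | ∃ (n : ℕ) (S : Literature.NumberTheory.Transcendental.KZ.IntegralRep (n + 1)) (r₀ g : Literature.NumberTheory.Transcendental.KZ.IntegralRep n), Literature.NumberTheory.Transcendental.KZ.IsDominatedFamily S r₀ g ∧ v = (Literature.NumberTheory.Transcendental.KZ.of S, Literature.NumberTheory.Transcendental.KZ.of r₀)} → D + G ∈ Literature.NumberTheory.Transcendental.KZ.fibredRelations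 → Literature.NumberTheory.Transcendental.KZ.eval y = 0 → y ∈ Literature.NumberTheory.Transcendental.KZ.relations) (hvs : ∀ D ∈ AddSubgroup.closure Summit.KontsevichZagierPeriods.ValuedFieldSpecialisation.elementaryGenerators, ∀ (G y : Literature.NumberTheory.Transcendental.KZ.FormalRep), (G, y) ∈ AddSubgroup.closure {v : Literature.NumberTheory.Transcendental.KZ.FormalRep × Literature.NumberTheory.Transcendental.KZ.FormalRep | ∃ (n : ℕ) (S : Literature.NumberTheory.Transcendental.KZ.IntegralRep (n + 1)) (r₀ g : Literature.NumberTheory.Transcendental.KZ.IntegralRep n), Literature.NumberTheory.Transcendental.KZ.IsDominatedFamily S r₀ g ∧ v = (Literature.NumberTheory.Transcendental.KZ.of S, Literature.NumberTheory.Transcendental.KZ.of r₀)} → D + G ∈ Literature.NumberTheory.Transcendental.KZ.fibredRelations → Literature.NumberTheory.Transcendental.KZ.eval y = 0) : ∀ D ∈ AddSubgroup.closure {x : Literature.NumberTheory.Transcendental.KZ.FormalRep | ∃ (p q b d : ℕ) (r : Literature.NumberTheory.Transcendental.KZ.IntegralRep d) (P : Literature.NumberTheory.Transcendental.KZ.IntegralRep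 (b + d + 1 + 1)), 0 < q ∧ (0 < p ∨ 0 < b) ∧ P.domain = {z | ∃ (s u : ℝ) (y : Fin b → ℝ) (w : Fin d → ℝ), z = Matrix.vecCons s (Matrix.vecCons u (Fin.append y w)) ∧ 0 < s ∧ s < 1 ∧ 0 < u ∧ u ^ q * s ^ p < 1 ∧ (∀ j, s ≤ y j ∧ y j ≤ 1) ∧ w ∈ r.domain} ∧ P.integrand = (fun z => (∏ j : Fin b, (z (Fin.castAdd d j).succ.succ)⁻¹) * r.integrand (fun l : Fin d => z (Fin.natAdd b l).succ.succ)) ∧ x = Literature.NumberTheory.Transcendental.KZ.of P}, ∀ (G y : Literature.NumberTheory.Transcendental.KZ.FormalRep), (G, y) ∈ AddSubgroup.closure {v : Literature.NumberTheory.Transcendental.KZ.FormalRep × Literature.NumberTheory.Transcendental.KZ.FormalRep | ∃ (n : ℕ) (S : Literature.NumberTheory.Transcendental.KZ.IntegralRep (n + 1)) (r₀ g : Literature.NumberTheory.Transcendental.KZ.IntegralRep n), ((∃ ε > (0 : ℝ), ∀ z ∈ S.domain, 0 < z 0 → z 0 < ε → (fun i : Fin n => z i.succ) ∈ g.domain ∧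 |S.integrand z| ≤ g.integrand (fun i : Fin n => z i.succ)) ∧ (∀ᵐ x : Fin n → ℝ, ∀ᶠ s in nhdsWithin (0 : ℝ) (Set.Ioi 0), (Matrix.vecCons s x ∈ S.domain ↔ x ∈ r₀.domain)) ∧ (∀ᵐ x : Fin n → ℝ, x ∈ r₀.domain → Filter.Tendsto (fun s : ℝ => S.integrand (Matrix.vecCons s x)) (nhdsWithin 0 (Set.Ioi 0)) (nhds (r₀.integrand x)))) ∧ v = (Literature.NumberTheory.Transcendental.KZ.of S, Literature.NumberTheory.Transcendental.KZ.of r₀)} → D + G ∈ AddSubgroup.closure (Literature.NumberTheory.Transcendental.KZ.domainAddRel ∪ Literature.NumberTheory.Transcendental.KZ.integrandAddRel ∪ {c | ∃ (n : ℕ) (r r' : Literature.NumberTheory.Transcendental.KZ.IntegralRep (n + 1)) (Φ : (Fin (n + 1) → ℝ) → (Fin (n + 1) → ℝ)) (Φ' : (Fin (n + 1) → ℝ) → (Fin (n + 1) → ℝ) →L[ℝ] (Fin (n + 1) → ℝ)), Literature.NumberTheory.Transcendental.IsSemialgebraicMapOn ℚ r.domain Φ ∧ (∀ x ∈ r.domain,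 HasFDerivWithinAt Φ (Φ' x) r.domain x) ∧ Set.InjOn Φ r.domain ∧ r'.domain = Φ '' r.domain ∧ (∀ x ∈ r.domain, r.integrand x = r'.integrand (Φ x) * |(Φ' x).det|) ∧ (∀ x ∈ r.domain, Φ x 0 = x 0) ∧ c = Literature.NumberTheory.Transcendental.KZ.of r - Literature.NumberTheory.Transcendental.KZ.of r'} ∪ {c | c ∈ Literature.NumberTheory.Transcendental.KZ.newtonLeibnizRel ∧ ∃ (n : ℕ) (r : Literature.NumberTheory.Transcendental.KZ.IntegralRep (n + 2)) (r' : Literature.NumberTheory.Transcendental.KZ.IntegralRep (n + 1)), c = Literature.NumberTheory.Transcendental.KZ.of r - Literature.NumberTheory.Transcendental.KZ.of r'}) → y ∈ Literature.NumberTheory.Transcendental.KZ.relations :=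
  fun D hD G y hGy hF => h2 D hD G y hGy hF (hvs D hD G y hGy hF)

/-- Birth stub 3 (constant term of a normal form, verbatim signature) from the general form (stub 3') with
`x = of R` (`sliceEval (of R) = sliceValue R`, and `HasConstantTerm R c` is the inlined expansion clause by
`Iff.rfl`). [folklore] -/
theorem constantTermOfNormalForm_of (h3 : ∀ (x : Literature.NumberTheory.Transcendental.KZ.FormalRep) (c : ℝ), Literature.NumberTheory.Transcendental.KZ.HasConstantTermAt (Literature.NumberTheory.Transcendental.KZ.sliceEval x) c → ∀ D ∈ AddSubgroup.closure Summit.KontsevichZagierPeriods.ValuedFieldSpecialisation.elementaryGenerators, ∀ (G y : Literature.NumberTheory.Transcendental.KZ.FormalRep), (G, y) ∈ AddSubgroup.closure {v : Literature.NumberTheory.Transcendental.KZ.FormalRep × Literature.NumberTheory.Transcendental.KZ.FormalRep | ∃ (n : ℕ) (S : Literature.NumberTheory.Transcendental.KZ.IntegralRep (n + 1)) (r₀ g : Literature.NumberTheory.Transcendental.KZ.IntegralRep n), Literature.NumberTheory.Transcendental.KZ.IsDominatedFamily S r₀ g ∧ v = (Literature.NumberTheory.Transcendental.KZ.of S, Literature.NumberTheory.Transcendental.KZ.of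 r₀)} → x - D - G ∈ Literature.NumberTheory.Transcendental.KZ.fibredRelations → Literature.NumberTheory.Transcendental.KZ.eval y = c) : ∀ (n : ℕ) (R : Literature.NumberTheory.Transcendental.KZ.IntegralRep (n + 1)) (c : ℝ), (∃ (k : ℕ) (a : Fin k → ℚ) (b : Fin k → ℕ) (w : Fin k → ℝ), (∀ i, a i < 0 ∨ (a i = 0 ∧ 0 < b i)) ∧ Filter.Tendsto (fun s : ℝ => (∫ x in {x : Fin n → ℝ | Matrix.vecCons s x ∈ R.domain}, R.integrand (Matrix.vecCons s x)) - ∑ i, w i * s ^ ((a i : ℚ) : ℝ) * Real.log s ^ (b i)) (nhdsWithin 0 (Set.Ioi 0)) (nhds c)) → ∀ D ∈ AddSubgroup.closure {x : Literature.NumberTheory.Transcendental.KZ.FormalRep | ∃ (p q b d : ℕ) (r : Literature.NumberTheory.Transcendental.KZ.IntegralRep d) (P : Literature.NumberTheory.Transcendental.KZ.IntegralRep (b + d + 1 + 1)), 0 < q ∧ (0 < p ∨ 0 < b) ∧ P.domain = {z | ∃ (s u : ℝ) (y : Fin b → ℝ) (w : Fin d → ℝ), z = Matrix.vecCons s (Matrix.vecCons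 u (Fin.append y w)) ∧ 0 < s ∧ s < 1 ∧ 0 < u ∧ u ^ q * s ^ p < 1 ∧ (∀ j, s ≤ y j ∧ y j ≤ 1) ∧ w ∈ r.domain} ∧ P.integrand = (fun z => (∏ j : Fin b, (z (Fin.castAdd d j).succ.succ)⁻¹) * r.integrand (fun l : Fin d => z (Fin.natAdd b l).succ.succ)) ∧ x = Literature.NumberTheory.Transcendental.KZ.of P}, ∀ (G y : Literature.NumberTheory.Transcendental.KZ.FormalRep), (G, y) ∈ AddSubgroup.closure {v : Literature.NumberTheory.Transcendental.KZ.FormalRep × Literature.NumberTheory.Transcendental.KZ.FormalRep | ∃ (n : ℕ) (S : Literature.NumberTheory.Transcendental.KZ.IntegralRep (n + 1)) (r₀ g : Literature.NumberTheory.Transcendental.KZ.IntegralRep n), ((∃ ε > (0 : ℝ), ∀ z ∈ S.domain, 0 < z 0 → z 0 < ε → (fun i : Fin n => z i.succ) ∈ g.domain ∧ |S.integrand z| ≤ g.integrand (fun i : Fin n => z i.succ)) ∧ (∀ᵐ x : Fin n → ℝ, ∀ᶠ s in nhdsWithin (0 : ℝ) (Set.Ioi 0), (Matrix.vecCons s x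 ∈ S.domain ↔ x ∈ r₀.domain)) ∧ (∀ᵐ x : Fin n → ℝ, x ∈ r₀.domain → Filter.Tendsto (fun s : ℝ => S.integrand (Matrix.vecCons s x)) (nhdsWithin 0 (Set.Ioi 0)) (nhds (r₀.integrand x)))) ∧ v = (Literature.NumberTheory.Transcendental.KZ.of S, Literature.NumberTheory.Transcendental.KZ.of r₀)} → Literature.NumberTheory.Transcendental.KZ.of R - D - G ∈ AddSubgroup.closure (Literature.NumberTheory.Transcendental.KZ.domainAddRel ∪ Literature.NumberTheory.Transcendental.KZ.integrandAddRel ∪ {c | ∃ (n : ℕ) (r r' : Literature.NumberTheory.Transcendental.KZ.IntegralRep (n + 1)) (Φ : (Fin (n + 1) → ℝ) → (Fin (n + 1) → ℝ)) (Φ' : (Fin (n + 1) → ℝ) → (Fin (n + 1) → ℝ) →L[ℝ] (Fin (n + 1) → ℝ)), Literature.NumberTheory.Transcendental.IsSemialgebraicMapOn ℚ r.domain Φ ∧ (∀ x ∈ r.domain, HasFDerivWithinAt Φ (Φ' x) r.domain x) ∧ Set.InjOn Φ r.domain ∧ r'.domain = Φ '' r.domain ∧ (∀ x ∈ r.domain,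 r.integrand x = r'.integrand (Φ x) * |(Φ' x).det|) ∧ (∀ x ∈ r.domain, Φ x 0 = x 0) ∧ c = Literature.NumberTheory.Transcendental.KZ.of r - Literature.NumberTheory.Transcendental.KZ.of r'} ∪ {c | c ∈ Literature.NumberTheory.Transcendental.KZ.newtonLeibnizRel ∧ ∃ (n : ℕ) (r : Literature.NumberTheory.Transcendental.KZ.IntegralRep (n + 2)) (r' : Literature.NumberTheory.Transcendental.KZ.IntegralRep (n + 1)), c = Literature.NumberTheory.Transcendental.KZ.of r - Literature.NumberTheory.Transcendental.KZ.of r'}) → Literature.NumberTheory.Transcendental.KZ.eval y = c := by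
  intro n R c hc D hD G y hGy hF
  refine h3 (KZ.of R) c ?_ D hD G y hGy hF
  rw [KZ.sliceEval_of]
  exact hc

end Glue

/-! ## The composition (sorry-free) -/

open Literature.NumberTheory.Transcendental

/-- Generator map of the constant-term hom: a positive-dimensional generator `[R]` goes to the special-fibre
class `y n R` of its chosen normal form, a dimension-`0` generator (no family structure) to `0`. [folklore] -/
noncomputable def ctGen (y : (n : ℕ) → KZ.IntegralRep (n + 1) → KZ.FormalRep) :
    (Σ n, KZ.IntegralRep n) → KZ.FormalRep
  | ⟨0, _⟩ => 0
  | ⟨n + 1, R⟩ => y n R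

theorem lift_ctGen_of_succ (y : (n : ℕ) → KZ.IntegralRep (n + 1) → KZ.FormalRep) (n : ℕ)
    (R : KZ.IntegralRep (n + 1)) :
    FreeAbelianGroup.lift (ctGen y) (KZ.of R) = y n R := by
  show FreeAbelianGroup.lift (ctGen y) (FreeAbelianGroup.of ⟨n + 1, R⟩) = y n R
  rw [FreeAbelianGroup.lift_apply_of]
  rfl

theorem lift_ctGen_of_zero (y : (n : ℕ) → KZ.IntegralRep (n + 1) → KZ.FormalRep)
    (R : KZ.IntegralRep 0) :
    FreeAbelianGroup.lift (ctGen y) (KZ.of R) = 0 := by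
  show FreeAbelianGroup.lift (ctGen y) (FreeAbelianGroup.of ⟨0, R⟩) = 0
  rw [FreeAbelianGroup.lift_apply_of]
  rfl

/-- The composition, arrow form: EXISTENCE of normal forms → RIGIDITY of special fibres → VALUE of the constant
term → `CTConstruction` (the conclusion is the crux UNFOLDED verbatim, so that exactly one theorem of this file,
`CTConstruction_of`, concludes the crux by its route name). Pure algebra in the free abelian group `KZ.FormalRep`
once a normal form is CHOSEN for every positive-dimensional generator. [folklore] -/
theorem ctConstruction_of_normalForms :
    (∀ (n : ℕ) (R : Literature.NumberTheory.Transcendental.KZ.IntegralRep (n + 1)), ∃ (D G : Literature.NumberTheory.Transcendental.KZ.FormalRep), (∃ (k : ℕ) (m : Fin k → ℤ) (p q b d : Fin k → ℕ) (r : (i : Fin k) → Literature.NumberTheory.Transcendental.KZ.IntegralRep (d i)) (P : (i : Fin k) → Literature.NumberTheory.Transcendental.KZ.IntegralRep (b i + d i + 1 + 1)), (∀ i, 0 < q i ∧ (0 < p i ∨ 0 < b i) ∧ (P i).domain = {z | ∃ (s u : ℝ) (y : Fin (b i) → ℝ) (w : Fin (d i) → ℝ), z = Matrix.vecCons s (Matrix.vecCons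 u (Fin.append y w)) ∧ 0 < s ∧ s < 1 ∧ 0 < u ∧ u ^ (q i) * s ^ (p i) < 1 ∧ (∀ j, s ≤ y j ∧ y j ≤ 1) ∧ w ∈ (r i).domain} ∧ (P i).integrand = fun z => (∏ j : Fin (b i), (z (Fin.castAdd (d i) j).succ.succ)⁻¹) * (r i).integrand (fun l : Fin (d i) => z (Fin.natAdd (b i) l).succ.succ)) ∧ D = ∑ i, m i • Literature.NumberTheory.Transcendental.KZ.of (P i)) ∧ (∃ (k : ℕ) (d : Fin k → ℕ) (m : Fin k → ℤ) (S : (i : Fin k) → Literature.NumberTheory.Transcendental.KZ.IntegralRep (d i + 1)) (r₀ g : (i : Fin k) → Literature.NumberTheory.Transcendental.KZ.IntegralRep (d i)), (∀ i, ((∃ ε > (0 : ℝ), ∀ z ∈ (S i).domain, 0 < z 0 → z 0 < ε → (fun i : Fin (d i) => z i.succ) ∈ (g i).domain ∧ |(S i).integrand z| ≤ (g i).integrand (fun i : Fin (d i) => z i.succ)) ∧ (∀ᵐ x : Fin (d i) → ℝ, ∀ᶠ s in nhdsWithin (0 : ℝ) (Set.Ioi 0), (Matrix.vecCons s x ∈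 (S i).domain ↔ x ∈ (r₀ i).domain)) ∧ (∀ᵐ x : Fin (d i) → ℝ, x ∈ (r₀ i).domain → Filter.Tendsto (fun s : ℝ => (S i).integrand (Matrix.vecCons s x)) (nhdsWithin 0 (Set.Ioi 0)) (nhds ((r₀ i).integrand x))))) ∧ G = ∑ i, m i • Literature.NumberTheory.Transcendental.KZ.of (S i)) ∧ Literature.NumberTheory.Transcendental.KZ.of R - D - G ∈ AddSubgroup.closure (Literature.NumberTheory.Transcendental.KZ.domainAddRel ∪ Literature.NumberTheory.Transcendental.KZ.integrandAddRel ∪ {c | ∃ (n : ℕ) (r r' : Literature.NumberTheory.Transcendental.KZ.IntegralRep (n + 1)) (Φ : (Fin (n + 1) → ℝ) → (Fin (n + 1) → ℝ)) (Φ' : (Fin (n + 1) → ℝ) → (Fin (n + 1) → ℝ) →L[ℝ] (Fin (n + 1) → ℝ)), Literature.NumberTheory.Transcendental.IsSemialgebraicMapOn ℚ r.domain Φ ∧ (∀ x ∈ r.domain, HasFDerivWithinAt Φ (Φ' x) r.domain x) ∧ Set.InjOn Φ r.domain ∧ r'.domain = Φ '' r.domain ∧ (∀ x ∈ r.domain,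 r.integrand x = r'.integrand (Φ x) * |(Φ' x).det|) ∧ (∀ x ∈ r.domain, Φ x 0 = x 0) ∧ c = Literature.NumberTheory.Transcendental.KZ.of r - Literature.NumberTheory.Transcendental.KZ.of r'} ∪ {c | c ∈ Literature.NumberTheory.Transcendental.KZ.newtonLeibnizRel ∧ ∃ (n : ℕ) (r : Literature.NumberTheory.Transcendental.KZ.IntegralRep (n + 2)) (r' : Literature.NumberTheory.Transcendental.KZ.IntegralRep (n + 1)), c = Literature.NumberTheory.Transcendental.KZ.of r - Literature.NumberTheory.Transcendental.KZ.of r'})) →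
    (∀ D ∈ AddSubgroup.closure {x : Literature.NumberTheory.Transcendental.KZ.FormalRep | ∃ (p q b d : ℕ) (r : Literature.NumberTheory.Transcendental.KZ.IntegralRep d) (P : Literature.NumberTheory.Transcendental.KZ.IntegralRep (b + d + 1 + 1)), 0 < q ∧ (0 < p ∨ 0 < b) ∧ P.domain = {z | ∃ (s u : ℝ) (y : Fin b → ℝ) (w : Fin d → ℝ), z = Matrix.vecCons s (Matrix.vecCons u (Fin.append y w)) ∧ 0 < s ∧ s < 1 ∧ 0 < u ∧ u ^ q * s ^ p < 1 ∧ (∀ j, s ≤ y j ∧ y j ≤ 1) ∧ w ∈ r.domain} ∧ P.integrand = (fun z => (∏ j : Fin b, (z (Fin.castAdd d j).succ.succ)⁻¹) * r.integrand (fun l : Fin d => z (Fin.natAdd b l).succ.succ)) ∧ x = Literature.NumberTheory.Transcendental.KZ.of P}, ∀ (G y : Literature.NumberTheory.Transcendental.KZ.FormalRep), (G, y) ∈ AddSubgroup.closure {v : Literature.NumberTheory.Transcendental.KZ.FormalRep × Literature.NumberTheory.Transcendental.KZ.FormalRep | ∃ (n : ℕ) (S : Literature.NumberTheory.Transcendental.KZ.IntegralRep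 (n + 1)) (r₀ g : Literature.NumberTheory.Transcendental.KZ.IntegralRep n), ((∃ ε > (0 : ℝ), ∀ z ∈ S.domain, 0 < z 0 → z 0 < ε → (fun i : Fin n => z i.succ) ∈ g.domain ∧ |S.integrand z| ≤ g.integrand (fun i : Fin n => z i.succ)) ∧ (∀ᵐ x : Fin n → ℝ, ∀ᶠ s in nhdsWithin (0 : ℝ) (Set.Ioi 0), (Matrix.vecCons s x ∈ S.domain ↔ x ∈ r₀.domain)) ∧ (∀ᵐ x : Fin n → ℝ, x ∈ r₀.domain → Filter.Tendsto (fun s : ℝ => S.integrand (Matrix.vecCons s x)) (nhdsWithin 0 (Set.Ioi 0)) (nhds (r₀.integrand x)))) ∧ v = (Literature.NumberTheory.Transcendental.KZ.of S, Literature.NumberTheory.Transcendental.KZ.of r₀)} → D + G ∈ AddSubgroup.closure (Literature.NumberTheory.Transcendental.KZ.domainAddRel ∪ Literature.NumberTheory.Transcendental.KZ.integrandAddRel ∪ {c | ∃ (n : ℕ) (r r' : Literature.NumberTheory.Transcendental.KZ.IntegralRep (n + 1)) (Φ : (Fin (n + 1) → ℝ) → (Fin (n + 1) → ℝ)) (Φ'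 : (Fin (n + 1) → ℝ) → (Fin (n + 1) → ℝ) →L[ℝ] (Fin (n + 1) → ℝ)), Literature.NumberTheory.Transcendental.IsSemialgebraicMapOn ℚ r.domain Φ ∧ (∀ x ∈ r.domain, HasFDerivWithinAt Φ (Φ' x) r.domain x) ∧ Set.InjOn Φ r.domain ∧ r'.domain = Φ '' r.domain ∧ (∀ x ∈ r.domain, r.integrand x = r'.integrand (Φ x) * |(Φ' x).det|) ∧ (∀ x ∈ r.domain, Φ x 0 = x 0) ∧ c = Literature.NumberTheory.Transcendental.KZ.of r - Literature.NumberTheory.Transcendental.KZ.of r'} ∪ {c | c ∈ Literature.NumberTheory.Transcendental.KZ.newtonLeibnizRel ∧ ∃ (n : ℕ) (r : Literature.NumberTheory.Transcendental.KZ.IntegralRep (n + 2)) (r' : Literature.NumberTheory.Transcendental.KZ.IntegralRep (n + 1)), c = Literature.NumberTheory.Transcendental.KZ.of r - Literature.NumberTheory.Transcendental.KZ.of r'}) → y ∈ Literature.NumberTheory.Transcendental.KZ.relations) →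
    (∀ (n : ℕ) (R : Literature.NumberTheory.Transcendental.KZ.IntegralRep (n + 1)) (c : ℝ), (∃ (k : ℕ) (a : Fin k → ℚ) (b : Fin k → ℕ) (w : Fin k → ℝ), (∀ i, a i < 0 ∨ (a i = 0 ∧ 0 < b i)) ∧ Filter.Tendsto (fun s : ℝ => (∫ x in {x : Fin n → ℝ | Matrix.vecCons s x ∈ R.domain}, R.integrand (Matrix.vecCons s x)) - ∑ i, w i * s ^ ((a i : ℚ) : ℝ) * Real.log s ^ (b i)) (nhdsWithin 0 (Set.Ioi 0)) (nhds c)) → ∀ D ∈ AddSubgroup.closure {x : Literature.NumberTheory.Transcendental.KZ.FormalRep | ∃ (p q b d : ℕ) (r : Literature.NumberTheory.Transcendental.KZ.IntegralRep d) (P : Literature.NumberTheory.Transcendental.KZ.IntegralRep (b + d + 1 + 1)), 0 < q ∧ (0 < p ∨ 0 < b) ∧ P.domain = {z | ∃ (s u : ℝ) (y : Fin b → ℝ) (w : Fin d → ℝ), z = Matrix.vecCons s (Matrix.vecCons u (Fin.append y w)) ∧ 0 < s ∧ s < 1 ∧ 0 < u ∧ u ^ q * s ^ p < 1 ∧ (∀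 j, s ≤ y j ∧ y j ≤ 1) ∧ w ∈ r.domain} ∧ P.integrand = (fun z => (∏ j : Fin b, (z (Fin.castAdd d j).succ.succ)⁻¹) * r.integrand (fun l : Fin d => z (Fin.natAdd b l).succ.succ)) ∧ x = Literature.NumberTheory.Transcendental.KZ.of P}, ∀ (G y : Literature.NumberTheory.Transcendental.KZ.FormalRep), (G, y) ∈ AddSubgroup.closure {v : Literature.NumberTheory.Transcendental.KZ.FormalRep × Literature.NumberTheory.Transcendental.KZ.FormalRep | ∃ (n : ℕ) (S : Literature.NumberTheory.Transcendental.KZ.IntegralRep (n + 1)) (r₀ g : Literature.NumberTheory.Transcendental.KZ.IntegralRep n), ((∃ ε > (0 : ℝ), ∀ z ∈ S.domain, 0 < z 0 → z 0 < ε → (fun i : Fin n => z i.succ) ∈ g.domain ∧ |S.integrand z| ≤ g.integrand (fun i : Fin n => z i.succ)) ∧ (∀ᵐ x : Fin n → ℝ, ∀ᶠ s in nhdsWithin (0 : ℝ) (Set.Ioi 0), (Matrix.vecCons s x ∈ S.domain ↔ x ∈ r₀.domain)) ∧ (∀ᵐ x : Fin n → ℝ, x ∈ r₀.domain → Filter.Tendsto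 (fun s : ℝ => S.integrand (Matrix.vecCons s x)) (nhdsWithin 0 (Set.Ioi 0)) (nhds (r₀.integrand x)))) ∧ v = (Literature.NumberTheory.Transcendental.KZ.of S, Literature.NumberTheory.Transcendental.KZ.of r₀)} → Literature.NumberTheory.Transcendental.KZ.of R - D - G ∈ AddSubgroup.closure (Literature.NumberTheory.Transcendental.KZ.domainAddRel ∪ Literature.NumberTheory.Transcendental.KZ.integrandAddRel ∪ {c | ∃ (n : ℕ) (r r' : Literature.NumberTheory.Transcendental.KZ.IntegralRep (n + 1)) (Φ : (Fin (n + 1) → ℝ) → (Fin (n + 1) → ℝ)) (Φ' : (Fin (n + 1) → ℝ) → (Fin (n + 1) → ℝ) →L[ℝ] (Fin (n + 1) → ℝ)), Literature.NumberTheory.Transcendental.IsSemialgebraicMapOn ℚ r.domain Φ ∧ (∀ x ∈ r.domain, HasFDerivWithinAt Φ (Φ' x) r.domain x) ∧ Set.InjOn Φ r.domain ∧ r'.domain = Φ '' r.domain ∧ (∀ x ∈ r.domain, r.integrand x = r'.integrand (Φ x) * |(Φ' x).det|) ∧ (∀ x ∈ r.domain, Φ x 0 = x 0) ∧ c = Literature.NumberTheory.Transcendental.KZ.of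 r - Literature.NumberTheory.Transcendental.KZ.of r'} ∪ {c | c ∈ Literature.NumberTheory.Transcendental.KZ.newtonLeibnizRel ∧ ∃ (n : ℕ) (r : Literature.NumberTheory.Transcendental.KZ.IntegralRep (n + 2)) (r' : Literature.NumberTheory.Transcendental.KZ.IntegralRep (n + 1)), c = Literature.NumberTheory.Transcendental.KZ.of r - Literature.NumberTheory.Transcendental.KZ.of r'}) → Literature.NumberTheory.Transcendental.KZ.eval y = c) →
    (∃ CT : Literature.NumberTheory.Transcendental.KZ.FormalRep →+ Literature.NumberTheory.Transcendental.KZ.FormalRep, (∀ (n : ℕ) (R : Literature.NumberTheory.Transcendental.KZ.IntegralRep (n + 1)) (c : ℝ), (∃ (k : ℕ) (a : Fin k → ℚ) (b : Fin k → ℕ) (w : Fin k → ℝ), (∀ i, a i < 0 ∨ (a i = 0 ∧ 0 < b i)) ∧ Filter.Tendsto (fun s : ℝ => (∫ x in {x : Fin n → ℝ | Matrix.vecCons s x ∈ R.domain}, R.integrand (Matrix.vecCons s x)) - ∑ i, w i * s ^ ((a i : ℚ) : ℝ) * Real.log s ^ (b i)) (nhdsWithin 0 (Set.Ioi 0)) (nhds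 c)) → Literature.NumberTheory.Transcendental.KZ.eval (CT (Literature.NumberTheory.Transcendental.KZ.of R)) = c) ∧ (∀ c ∈ (Literature.NumberTheory.Transcendental.KZ.domainAddRel ∪ Literature.NumberTheory.Transcendental.KZ.integrandAddRel ∪ {c | ∃ (n : ℕ) (r r' : Literature.NumberTheory.Transcendental.KZ.IntegralRep (n + 1)) (Φ : (Fin (n + 1) → ℝ) → (Fin (n + 1) → ℝ)) (Φ' : (Fin (n + 1) → ℝ) → (Fin (n + 1) → ℝ) →L[ℝ] (Fin (n + 1) → ℝ)), Literature.NumberTheory.Transcendental.IsSemialgebraicMapOn ℚ r.domain Φ ∧ (∀ x ∈ r.domain, HasFDerivWithinAt Φ (Φ' x) r.domain x) ∧ Set.InjOn Φ r.domain ∧ r'.domain = Φ '' r.domain ∧ (∀ x ∈ r.domain, r.integrand x = r'.integrand (Φ x) * |(Φ' x).det|) ∧ (∀ x ∈ r.domain, Φ x 0 = x 0) ∧ c = Literature.NumberTheory.Transcendental.KZ.of r - Literature.NumberTheory.Transcendental.KZ.of r'} ∪ {c | c ∈ Literature.NumberTheory.Transcendental.KZ.newtonLeibnizRel ∧ ∃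 (n : ℕ) (r : Literature.NumberTheory.Transcendental.KZ.IntegralRep (n + 2)) (r' : Literature.NumberTheory.Transcendental.KZ.IntegralRep (n + 1)), c = Literature.NumberTheory.Transcendental.KZ.of r - Literature.NumberTheory.Transcendental.KZ.of r'}), CT c ∈ Literature.NumberTheory.Transcendental.KZ.relations) ∧ (∀ (n : ℕ) (R : Literature.NumberTheory.Transcendental.KZ.IntegralRep (n + 1)) (r₀ g : Literature.NumberTheory.Transcendental.KZ.IntegralRep n), ((∃ ε > (0 : ℝ), ∀ z ∈ R.domain, 0 < z 0 → z 0 < ε → (fun i : Fin n => z i.succ) ∈ g.domain ∧ |R.integrand z| ≤ g.integrand (fun i : Fin n => z i.succ)) ∧ (∀ᵐ x : Fin n → ℝ, ∀ᶠ s in nhdsWithin (0 : ℝ) (Set.Ioi 0), (Matrix.vecCons s x ∈ R.domain ↔ x ∈ r₀.domain)) ∧ (∀ᵐ x : Fin n → ℝ, x ∈ r₀.domain → Filter.Tendsto (fun s : ℝ => R.integrand (Matrix.vecCons s x)) (nhdsWithin 0 (Set.Ioi 0)) (nhds (r₀.integrand x)))) → CT (Literature.NumberTheory.Transcendental.KZ.of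 R) - Literature.NumberTheory.Transcendental.KZ.of r₀ ∈ Literature.NumberTheory.Transcendental.KZ.relations)) := by
  intro hE hR hV
  classical
  -- Step 0: normal forms in subgroup form (elementary part in the closure of the elementary classes, dominated
  -- part paired with its special-fibre combination in the closure of the dominated pairs).
  have hNF : ∀ (n : ℕ) (R : KZ.IntegralRep (n + 1)), ∃ (D G y : KZ.FormalRep),
      D ∈ AddSubgroup.closure {x : Literature.NumberTheory.Transcendental.KZ.FormalRep | ∃ (p q b d : ℕ) (r : Literature.NumberTheory.Transcendental.KZ.IntegralRep d) (P : Literature.NumberTheory.Transcendental.KZ.IntegralRep (b + d + 1 + 1)), 0 < q ∧ (0 < p ∨ 0 < b) ∧ P.domain = {z | ∃ (s u : ℝ) (y : Fin b → ℝ) (w : Fin d → ℝ), z = Matrix.vecCons s (Matrix.vecCons u (Fin.append y w)) ∧ 0 < s ∧ s < 1 ∧ 0 < u ∧ u ^ q * s ^ p < 1 ∧ (∀ j, s ≤ y j ∧ y j ≤ 1) ∧ w ∈ r.domain} ∧ P.integrand = (fun z => (∏ j : Fin b, (z (Fin.castAdd d j).succ.succ)⁻¹) * r.integrand (fun l : Fin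 d => z (Fin.natAdd b l).succ.succ)) ∧ x = Literature.NumberTheory.Transcendental.KZ.of P} ∧
      (G, y) ∈ AddSubgroup.closure {v : Literature.NumberTheory.Transcendental.KZ.FormalRep × Literature.NumberTheory.Transcendental.KZ.FormalRep | ∃ (n : ℕ) (S : Literature.NumberTheory.Transcendental.KZ.IntegralRep (n + 1)) (r₀ g : Literature.NumberTheory.Transcendental.KZ.IntegralRep n), ((∃ ε > (0 : ℝ), ∀ z ∈ S.domain, 0 < z 0 → z 0 < ε → (fun i : Fin n => z i.succ) ∈ g.domain ∧ |S.integrand z| ≤ g.integrand (fun i : Fin n => z i.succ)) ∧ (∀ᵐ x : Fin n → ℝ, ∀ᶠ s in nhdsWithin (0 : ℝ) (Set.Ioi 0), (Matrix.vecCons s x ∈ S.domain ↔ x ∈ r₀.domain)) ∧ (∀ᵐ x : Fin n → ℝ, x ∈ r₀.domain → Filter.Tendsto (fun s : ℝ => S.integrand (Matrix.vecCons s x)) (nhdsWithin 0 (Set.Ioi 0)) (nhds (r₀.integrand x)))) ∧ v = (Literature.NumberTheory.Transcendental.KZ.of S, Literature.NumberTheory.Transcendental.KZ.of r₀)} ∧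
      KZ.of R - D - G ∈ AddSubgroup.closure (Literature.NumberTheory.Transcendental.KZ.domainAddRel ∪ Literature.NumberTheory.Transcendental.KZ.integrandAddRel ∪ {c | ∃ (n : ℕ) (r r' : Literature.NumberTheory.Transcendental.KZ.IntegralRep (n + 1)) (Φ : (Fin (n + 1) → ℝ) → (Fin (n + 1) → ℝ)) (Φ' : (Fin (n + 1) → ℝ) → (Fin (n + 1) → ℝ) →L[ℝ] (Fin (n + 1) → ℝ)), Literature.NumberTheory.Transcendental.IsSemialgebraicMapOn ℚ r.domain Φ ∧ (∀ x ∈ r.domain, HasFDerivWithinAt Φ (Φ' x) r.domain x) ∧ Set.InjOn Φ r.domain ∧ r'.domain = Φ '' r.domain ∧ (∀ x ∈ r.domain, r.integrand x = r'.integrand (Φ x) * |(Φ' x).det|) ∧ (∀ x ∈ r.domain, Φ x 0 = x 0) ∧ c = Literature.NumberTheory.Transcendental.KZ.of r - Literature.NumberTheory.Transcendental.KZ.of r'} ∪ {c | c ∈ Literature.NumberTheory.Transcendental.KZ.newtonLeibnizRel ∧ ∃ (n : ℕ) (r : Literature.NumberTheory.Transcendental.KZ.IntegralRep (n + 2)) (r'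 : Literature.NumberTheory.Transcendental.KZ.IntegralRep (n + 1)), c = Literature.NumberTheory.Transcendental.KZ.of r - Literature.NumberTheory.Transcendental.KZ.of r'}) := by
    intro n R
    obtain ⟨D, G, ⟨k, m, p, q, b, d, r, P, hP, hD⟩, ⟨k', d', m', S, r₀, g, hS, hG⟩, hmem⟩ := hE n R
    refine ⟨D, G, ∑ i, m' i • KZ.of (r₀ i), ?_, ?_, hmem⟩
    · -- each elementary divergent product family is a generator of the elementary subgroup
      have hPmem : ∀ i, KZ.of (P i) ∈ {x : Literature.NumberTheory.Transcendental.KZ.FormalRep | ∃ (p q b d : ℕ) (r : Literature.NumberTheory.Transcendental.KZ.IntegralRep d) (P : Literature.NumberTheory.Transcendental.KZ.IntegralRep (b + d + 1 + 1)), 0 < q ∧ (0 < p ∨ 0 < b) ∧ P.domain = {z | ∃ (s u : ℝ) (y : Fin b → ℝ) (w : Fin d → ℝ), z = Matrix.vecCons s (Matrix.vecCons u (Fin.append y w)) ∧ 0 < s ∧ s < 1 ∧ 0 < u ∧ u ^ q * s ^ p < 1 ∧ (∀ j, s ≤ y j ∧ y j ≤ 1) ∧ w ∈ r.domain} ∧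 P.integrand = (fun z => (∏ j : Fin b, (z (Fin.castAdd d j).succ.succ)⁻¹) * r.integrand (fun l : Fin d => z (Fin.natAdd b l).succ.succ)) ∧ x = Literature.NumberTheory.Transcendental.KZ.of P} := fun i =>
        ⟨p i, q i, b i, d i, r i, P i, (hP i).1, (hP i).2.1, (hP i).2.2.1, (hP i).2.2.2, rfl⟩
      rw [hD]
      exact sum_mem fun i _ => zsmul_mem (AddSubgroup.subset_closure (hPmem i)) _
    · -- each dominated family, paired with its special fibre, is a generator of the pair subgroup
      have hSmem : ∀ i, (KZ.of (S i), KZ.of (r₀ i)) ∈ {v : Literature.NumberTheory.Transcendental.KZ.FormalRep × Literature.NumberTheory.Transcendental.KZ.FormalRep | ∃ (n : ℕ) (S : Literature.NumberTheory.Transcendental.KZ.IntegralRep (n + 1)) (r₀ g : Literature.NumberTheory.Transcendental.KZ.IntegralRep n), ((∃ ε > (0 : ℝ), ∀ z ∈ S.domain, 0 < z 0 → z 0 < ε → (fun i : Fin n => z i.succ) ∈ g.domain ∧ |S.integrand z| ≤ g.integrand (fun i : Fin n => z i.succ)) ∧ (∀ᵐ x : Fin n → ℝ, ∀ᶠ s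 in nhdsWithin (0 : ℝ) (Set.Ioi 0), (Matrix.vecCons s x ∈ S.domain ↔ x ∈ r₀.domain)) ∧ (∀ᵐ x : Fin n → ℝ, x ∈ r₀.domain → Filter.Tendsto (fun s : ℝ => S.integrand (Matrix.vecCons s x)) (nhdsWithin 0 (Set.Ioi 0)) (nhds (r₀.integrand x)))) ∧ v = (Literature.NumberTheory.Transcendental.KZ.of S, Literature.NumberTheory.Transcendental.KZ.of r₀)} := fun i =>
        ⟨d' i, S i, r₀ i, g i, hS i, rfl⟩
      have hY : (∑ i, m' i • (KZ.of (S i), KZ.of (r₀ i))) ∈ AddSubgroup.closure {v : Literature.NumberTheory.Transcendental.KZ.FormalRep × Literature.NumberTheory.Transcendental.KZ.FormalRep | ∃ (n : ℕ) (S : Literature.NumberTheory.Transcendental.KZ.IntegralRep (n + 1)) (r₀ g : Literature.NumberTheory.Transcendental.KZ.IntegralRep n), ((∃ ε > (0 : ℝ), ∀ z ∈ S.domain, 0 < z 0 → z 0 < ε → (fun i : Fin n => z i.succ) ∈ g.domain ∧ |S.integrand z| ≤ g.integrand (fun i : Fin n => z i.succ)) ∧ (∀ᵐ x : Fin n → ℝ,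 ∀ᶠ s in nhdsWithin (0 : ℝ) (Set.Ioi 0), (Matrix.vecCons s x ∈ S.domain ↔ x ∈ r₀.domain)) ∧ (∀ᵐ x : Fin n → ℝ, x ∈ r₀.domain → Filter.Tendsto (fun s : ℝ => S.integrand (Matrix.vecCons s x)) (nhdsWithin 0 (Set.Ioi 0)) (nhds (r₀.integrand x)))) ∧ v = (Literature.NumberTheory.Transcendental.KZ.of S, Literature.NumberTheory.Transcendental.KZ.of r₀)} :=
        sum_mem fun i _ => zsmul_mem (AddSubgroup.subset_closure (hSmem i)) _
      have hEq : (∑ i, m' i • (KZ.of (S i), KZ.of (r₀ i))) =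
          (∑ i, m' i • KZ.of (S i), ∑ i, m' i • KZ.of (r₀ i)) := by
        ext <;> simp [Prod.fst_sum, Prod.snd_sum]
      rw [hG, ← hEq]
      exact hY
  choose D G y hD hGy hF using hNF
  refine ⟨FreeAbelianGroup.lift (ctGen y), ?_, ?_, ?_⟩
  · -- (CT1) the value of the constant-term class is the constant term
    intro n R c hc
    rw [lift_ctGen_of_succ]
    exact hV n R c hc (D n R) (hD n R) (G n R) (y n R) (hGy n R) (hF n R)
  · -- (CT2) fibred move generators go to relations
    intro c hc
    have hcF : c ∈ AddSubgroup.closure (Literature.NumberTheory.Transcendental.KZ.domainAddRel ∪ Literature.NumberTheory.Transcendental.KZ.integrandAddRel ∪ {c | ∃ (n : ℕ) (r r' : Literature.NumberTheory.Transcendental.KZ.IntegralRep (n + 1)) (Φ : (Fin (n + 1) → ℝ) → (Fin (n + 1) → ℝ)) (Φ' : (Fin (n + 1) → ℝ) → (Fin (n + 1) → ℝ) →L[ℝ] (Fin (n + 1) → ℝ)), Literature.NumberTheory.Transcendental.IsSemialgebraicMapOn ℚ r.domain Φ ∧ (∀ x ∈ r.domain, HasFDerivWithinAt Φ (Φ'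 x) r.domain x) ∧ Set.InjOn Φ r.domain ∧ r'.domain = Φ '' r.domain ∧ (∀ x ∈ r.domain, r.integrand x = r'.integrand (Φ x) * |(Φ' x).det|) ∧ (∀ x ∈ r.domain, Φ x 0 = x 0) ∧ c = Literature.NumberTheory.Transcendental.KZ.of r - Literature.NumberTheory.Transcendental.KZ.of r'} ∪ {c | c ∈ Literature.NumberTheory.Transcendental.KZ.newtonLeibnizRel ∧ ∃ (n : ℕ) (r : Literature.NumberTheory.Transcendental.KZ.IntegralRep (n + 2)) (r' : Literature.NumberTheory.Transcendental.KZ.IntegralRep (n + 1)), c = Literature.NumberTheory.Transcendental.KZ.of r - Literature.NumberTheory.Transcendental.KZ.of r'}) := AddSubgroup.subset_closure hc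
    rcases hc with ((hc | hc) | hc) | hc
    · -- (1a) additivity in the domain
      obtain ⟨m, r, r₁, r₂, -, -, -, -, rfl⟩ := hc
      cases m with
      | zero =>
        rw [map_sub, map_sub, lift_ctGen_of_zero, lift_ctGen_of_zero, lift_ctGen_of_zero, sub_zero, sub_zero]
        exact zero_mem _
      | succ n =>
        rw [map_sub, map_sub, lift_ctGen_of_succ, lift_ctGen_of_succ, lift_ctGen_of_succ]
        refine hR (D n r - D n r₁ - D n r₂) (sub_mem (sub_mem (hD n r) (hD n r₁)) (hD n r₂))
          (G n r - G n r₁ - G n r₂) (y n r - y n r₁ - y n r₂) ?_ ?_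
        · simpa using sub_mem (sub_mem (hGy n r) (hGy n r₁)) (hGy n r₂)
        · have h := add_mem (add_mem (sub_mem hcF (hF n r)) (hF n r₁)) (hF n r₂)
          convert h using 1
          abel
    · -- (1b) additivity in the integrand
      obtain ⟨m, r, r₁, r₂, -, -, -, rfl⟩ := hc
      cases m with
      | zero =>
        rw [map_sub, map_sub, lift_ctGen_of_zero, lift_ctGen_of_zero, lift_ctGen_of_zero, sub_zero, sub_zero]
        exact zero_mem _
      | succ n =>
        rw [map_sub, map_sub, lift_ctGen_of_succ, lift_ctGen_of_succ, lift_ctGen_of_succ]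
        refine hR (D n r - D n r₁ - D n r₂) (sub_mem (sub_mem (hD n r) (hD n r₁)) (hD n r₂))
          (G n r - G n r₁ - G n r₂) (y n r - y n r₁ - y n r₂) ?_ ?_
        · simpa using sub_mem (sub_mem (hGy n r) (hGy n r₁)) (hGy n r₂)
        · have h := add_mem (add_mem (sub_mem hcF (hF n r)) (hF n r₁)) (hF n r₂)
          convert h using 1
          abel
    · -- (2) fibred change of variables
      obtain ⟨n, r, r', Φ, Φ', -, -, -, -, -, -, rfl⟩ := hc
      rw [map_sub, lift_ctGen_of_succ, lift_ctGen_of_succ]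
      refine hR (D n r - D n r') (sub_mem (hD n r) (hD n r')) (G n r - G n r') (y n r - y n r') ?_ ?_
      · simpa using sub_mem (hGy n r) (hGy n r')
      · have h := add_mem (sub_mem hcF (hF n r)) (hF n r')
        convert h using 1
        abel
    · -- (3) fibred Newton–Leibniz along the last coordinate (base dimension ≥ 1)
      obtain ⟨-, n, r, r', rfl⟩ := hc
      rw [map_sub, lift_ctGen_of_succ, lift_ctGen_of_succ]
      refine hR (D (n + 1) r - D n r') (sub_mem (hD (n + 1) r) (hD n r')) (G (n + 1) r - G n r')
        (y (n + 1) r - y n r') ?_ ?_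
      · simpa using sub_mem (hGy (n + 1) r) (hGy n r')
      · have h := add_mem (sub_mem hcF (hF (n + 1) r)) (hF n r')
        convert h using 1
        abel
  · -- (CT3) a dominated family goes to its special fibre: compare the chosen normal form with the trivial one
    intro n R r₀ g hdom
    rw [lift_ctGen_of_succ]
    have hgen0 : (KZ.of R, KZ.of r₀) ∈ {v : Literature.NumberTheory.Transcendental.KZ.FormalRep × Literature.NumberTheory.Transcendental.KZ.FormalRep | ∃ (n : ℕ) (S : Literature.NumberTheory.Transcendental.KZ.IntegralRep (n + 1)) (r₀ g : Literature.NumberTheory.Transcendental.KZ.IntegralRep n), ((∃ ε > (0 : ℝ), ∀ z ∈ S.domain, 0 < z 0 → z 0 < ε → (fun i : Fin n => z i.succ) ∈ g.domain ∧ |S.integrand z| ≤ g.integrand (fun i : Fin n => z i.succ)) ∧ (∀ᵐ x : Fin n → ℝ, ∀ᶠ s in nhdsWithin (0 : ℝ) (Set.Ioi 0), (Matrix.vecCons s x ∈ S.domain ↔ x ∈ r₀.domain)) ∧ (∀ᵐ x : Fin n → ℝ, x ∈ r₀.domain → Filter.Tendsto (fun s : ℝ => S.integrand (Matrix.vecCons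 s x)) (nhdsWithin 0 (Set.Ioi 0)) (nhds (r₀.integrand x)))) ∧ v = (Literature.NumberTheory.Transcendental.KZ.of S, Literature.NumberTheory.Transcendental.KZ.of r₀)} := ⟨n, R, r₀, g, hdom, rfl⟩
    have hgen : (KZ.of R, KZ.of r₀) ∈ AddSubgroup.closure {v : Literature.NumberTheory.Transcendental.KZ.FormalRep × Literature.NumberTheory.Transcendental.KZ.FormalRep | ∃ (n : ℕ) (S : Literature.NumberTheory.Transcendental.KZ.IntegralRep (n + 1)) (r₀ g : Literature.NumberTheory.Transcendental.KZ.IntegralRep n), ((∃ ε > (0 : ℝ), ∀ z ∈ S.domain, 0 < z 0 → z 0 < ε → (fun i : Fin n => z i.succ) ∈ g.domain ∧ |S.integrand z| ≤ g.integrand (fun i : Fin n => z i.succ)) ∧ (∀ᵐ x : Fin n → ℝ, ∀ᶠ s in nhdsWithin (0 : ℝ) (Set.Ioi 0), (Matrix.vecCons s x ∈ S.domain ↔ x ∈ r₀.domain)) ∧ (∀ᵐ x : Fin n → ℝ, x ∈ r₀.domain → Filter.Tendsto (fun s : ℝ => S.integrand (Matrix.vecCons s x)) (nhdsWithin 0 (Set.Ioi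 0)) (nhds (r₀.integrand x)))) ∧ v = (Literature.NumberTheory.Transcendental.KZ.of S, Literature.NumberTheory.Transcendental.KZ.of r₀)} :=
      AddSubgroup.subset_closure hgen0
    have key := hR (-(D n R)) (neg_mem (hD n R)) (KZ.of R - G n R) (KZ.of r₀ - y n R)
      (by simpa using sub_mem hgen (hGy n R)) (by convert hF n R using 1; abel)
    simpa using neg_mem key

/-- **Skeleton theorem** (concludes the crux BY NAME): `CTConstruction` from the five registered stubs through
the sorry-free glue and the birth composition. -/
theorem CTConstruction_of : CTConstruction :=
  ctConstruction_of_normalForms stub_classLevelExpansion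
    (specialFibreRigidity_of stub_specialFibreRigidityOfEval
      (valueShadow_of (stub_constantTermOfNormalForm' stub_elementarySliceValue stub_divergentMonomialsFilter)))
    (constantTermOfNormalForm_of
      (stub_constantTermOfNormalForm' stub_elementarySliceValue stub_divergentMonomialsFilter))

end Summit.KontsevichZagierPeriods.KontsevichZagierPeriods.Cruxes.CTConstruction.Birth
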